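import Literature.MathematicalPhysics.QuantumFieldTheory.Balaban1983to89.B1Sect3Statements
import Literature.MathematicalPhysics.QuantumFieldTheory.Balaban1983to89.B1RG242

/-!
# `Balaban1983to89.B1Eq314Proof` — [Balaban1982Higgs1] (3.14) p. 614 (Taylor formula for `exp` with the integral
remainder `R_{n̄+1}`) and (3.11) p. 614 (the splitting of the quadratic form of (3.7) under the translation (3.10)),
PROVED for the decls of record `B1Sect3Statements.Eq314` and `B1Sect3Statements.Split311`

HONEST FRAMING (cell `lit-balaban`, verbatim): statement-level skeleton of published theorems with citation tags;
proofs where landed; nothing here is a claim about the Yang–Mills mass gap.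

CITATION HEADER.  T. Bałaban, *(Higgs)₂,₃ quantum fields in a finite volume. I. A lower bound*, Commun. Math.
Phys. **85** (1982) 603–626, doi:10.1007/bf01403506 [Balaban1982Higgs1] (cell paper B1; PDF held
`paper:balaban1982-cmp85-higgs23-i`, journal page = PDF page + 602; the displays below were read as images on the x2
renders `run/shared/lean/pub/pub-balaban/b2b-balaban-ref1/pages/1982-cmp85-higgs23-I/…-p008/p009/p011/p012-x2.png`).
Unit `lit-balaban-p14` (Phase 2, PHASE2-TARGETS.md §G.3 seat p14, v1.1 riders), SKELETON rows `B1.Eq3.14` (decl of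
record `B1Sect3Statements.Eq314`, typed p239973, reader r12) and `B1.Eq3.11` (decl of record
`B1Sect3Statements.Split311`, typed p239973).  HOME `run/shared/lean/pub/lit-balaban/` (seat dir `lit-balaban-p14/`).

WHAT IS PRINTED (verbatim).  p. 614 [PDF 12]: *"The next step is the translation in the fields A:
A = A′ + aL⁻²C^{(0)}Q*B =: A′ + B^{(1)} (3.10) separating the quadratic form in the fields A, B in (3.7) into a sum of
two forms ½⟨B, Δ^{(1),L}B⟩ + ½(aL^{d−2} Σ_{y∈T′₁} |(QA′)(y)|² + ⟨A′, (−Δ + μ₀²ε²)A′⟩) = ½⟨B, Δ^{(1),L}B⟩ +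
½⟨A′, (C^{(0)})⁻¹A′⟩. (3.11)"*; the quadratic form of (3.7) p. 613 being *"½aL^{d−2} Σ_{y∈T′₁} |B(y) − (QA)(y)|² +
½⟨A, (−Δ + μ₀²ε²)A⟩"* (minus the exponent), with, p. 611 (2.31), *"C^{(k)}(Ω,A) = (aL⁻²P(A) + Δ^{(k)}(Ω,A))⁻¹"*,
p. 610 (2.20) *"P_k(A) = Q*_k(A)Q_k(A)"*, (2.17) *"Δ^{(0),ε}(Ω,A) = −Δ^{ε,N}_{A,Ω} + m²"*, and (2.18)/(2.21) defining
Δ^{(k+1),L^{k+1}ε} as the form left after the Gaussian integration of the k-th step, *"⟨ψ, Δ^{(k),L^kε}(Ω,A)ψ⟩ =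
a_k(L^kε)⁻²⟨ψ,ψ⟩ − a_k²(L^kε)⁻⁴⟨ψ, Q_k(A)G^ε_k(Ω,A)Q*_k(A)ψ⟩. (2.21)"*.  p. 614: *"U(A) = exp(ηqe(L^kε)A) = 1 +
Σ_{n=1}^{n̄} (ηqe(L^kε)A)ⁿ/n! + (ηqe(L^kε)A)^{n̄+1}/(n̄+1)! R_{n̄+1}(ηqe(L^kε)A) =: 1 + ηF_{1,k}(A) =: 1 + F′_{1,k}(A),
(3.14) where … R_{n̄+1}(z) is an analytic function of z defined by the formula
R_{n̄+1}(z) = (n̄+1)∫₀¹(1−t)^{n̄}e^{tz}dt."*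

WHAT THIS MODULE PROVES (no new definition, no new `Prop` fact; axioms standard).
* `eq314_holds : ∀ n̄ z, B1Sect3Statements.Eq314 n̄ z` — (3.14) AS TYPED, for every `n̄ : ℕ` and every `z : ℂ`:
  `exp z = Σ_{n ≤ n̄} zⁿ/n! + z^{n̄+1}/(n̄+1)! · R_{n̄+1}(z)` with r12's `B1Sect3Statements.taylorRem n̄ z =
  (n̄+1)∫₀¹(1−t)^{n̄}e^{tz}dt`.  Proof (the textbook one): by induction on `n̄`, the step being the integration by
  parts `(n+1)∫₀¹(1−t)ⁿe^{tz}dt = 1 + z∫₀¹(1−t)^{n+1}e^{tz}dt`, obtained from the fundamental theorem of calculus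
  (`intervalIntegral.integral_eq_sub_of_hasDerivAt`) applied to `t ↦ −(1−t)^{n+1}e^{tz}`; the base case
  `z∫₀¹e^{tz}dt = e^z − 1` likewise.  No division by `z` occurs, so `z = 0` needs no separate treatment.
* (3.11) = completing the square.  `Split311 c C Q* qAB qB qA′` (r12) says: for all `A′, B`,
  `qAB(A′ + c·C Q*B, B) = qB(B) + qA′(A′)`; it is parameterised by ABSTRACT forms, so it is proved here under the
  hypotheses that make it the printed statement (PHASE2-PACKETS p14), at three levels of concreteness:
  - `split311_of_minimiser` / `split311_of_minimiser'` — over real vector spaces `V ∋ A`, `U ∋ B` with bilinear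
    scalar products `⟨·,·⟩_V`, `⟨·,·⟩_U` ((1.5) p. 604; the latter symmetric), `Q : V → U` linear with adjoint `Q*`
    (*"The adjoint operators with respect to the scalar product (1.5)"*, p. 604), `D : V → V` symmetric (↤ −Δ + μ₀²ε²,
    or Δ^{(k)} at step k), `c` (↤ aL⁻²) and `C` a right inverse of `cQ*Q + D` (↤ C^{(0)} = (aL⁻²P + Δ^{(0)})⁻¹,
    (2.31) with (2.17)): for `qAB(A,B) = ½c⟨B − QA, B − QA⟩_U + ½⟨A, DA⟩_V` (the (3.7) form: `aL^{d−2}Σ_{y∈T′₁}|·|²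
    = aL⁻²⟨·,·⟩_{T′₁}`, the unit-lattice rescaling of (1.5) on the L-lattice carrying the weight `L^d`) one gets
    `qB(B) = ½⟨B, (c·1 − c²·QCQ*)B⟩_U` (= ½⟨B, Δ^{(1),L}B⟩ by (2.21) at k = 1, G₁ = C^{(0)}, a₁ = a — cf.
    `B1RG242` §E) and `qA′(A′) = ½(c⟨QA′, QA′⟩_U + ⟨A′, DA′⟩_V)` (the printed middle member of (3.11)) `=
    ½⟨A′, (cQ*Q + D)A′⟩_V` (the printed right member, `(C^{(0)})⁻¹ = aL⁻²Q*Q + (−Δ + μ₀²ε²)`);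
  - `split311_inner` — the same over Mathlib real inner-product spaces, with `‖B − QA‖²` as in (3.7);
  - `split311_matrix`, `split311_stepData`, `split311_stepData_221` — MODEL INSTANCE on the tree's concrete carrier of
    B1 Sect. 2, `B1RG242.StepData` (finite lattices, operators = real matrices, scalar products (1.5) = weight
    matrices `W_K`, `W_M` as in `B1RG242.StepData.ScalarProducts`): `c = S.β` (= aL⁻² after rescaling), `C = S.Ck`
    (= C^{(k)} (2.30)/(2.31)), `D = S.Δk` (= Δ^{(k)} (2.21)), `(C^{(k)})⁻¹ = S.β • S.P + S.Δk`, and `Δ^{(k+1)} =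
    β·1 − β²·QC^{(k)}Q*`, which `B1RG242.StepData.display221_succ` identifies with the printed (2.21)-form
    `γ·1 − γ²·Q_{k+1}G_{k+1}Q*_{k+1}` one level up (`split311_stepData_221`).  This is (3.11) at k = 0 and its k-th
    step repetition (3.41) p. 619 / (3.49) p. 621 (same display shape, `C^{(k)}` for `C^{(0)}`); the symmetry of
    `Δ^{(k)}` for `⟨·,·⟩_K` that the instance needs is DERIVED (`stepData_Δk_symm`) from the symmetry of
    `−Δ^{ε,N}_{A,Ω} + m²` and of the weights and the adjointness of `Q*_k` — the Euclidean structure of (1.5).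
Nothing else is asserted: the Gaussian-integral reading of (2.18) (why `β·1 − β²·QC^{(k)}Q*` IS Δ^{(k+1)}) stays the
folklore dictionary of `B1RG242`'s module docstring (i); Bałaban's operators `Q`, `Q*`, `−Δ`, `C^{(0)}` are not
constructed here (they are data + the printed structural hypotheses, as everywhere in the B1 files). -/

namespace Literature.MathematicalPhysics.QuantumFieldTheory.Balaban1983to89.B1Eq314Proof

open Literature.MathematicalPhysics.QuantumFieldTheory.Balaban1983to89
open B1Sect3Statements

/-! ## 1. (3.14): `exp z = Σ_{n ≤ n̄} zⁿ/n! + z^{n̄+1}/(n̄+1)! · R_{n̄+1}(z)`,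
`R_{n̄+1}(z) = (n̄+1)∫₀¹(1−t)^{n̄}e^{tz}dt` -/

section Taylor

open Complex intervalIntegral

/-- FTC kernel for the base case: `d/dt e^{tz} = z e^{tz}`. [folklore] -/
private theorem hasDerivAt_exp_line (z : ℂ) (t : ℝ) :
    HasDerivAt (fun s : ℝ => cexp ((s : ℂ) * z)) (z * cexp ((t : ℂ) * z)) t := by
  have h : HasDerivAt (fun w : ℂ => cexp (w * z)) (cexp ((t : ℂ) * z) * (1 * z)) (t : ℂ) :=
    ((hasDerivAt_id' (t : ℂ)).mul_const z).cexp
  exact h.comp_ofReal.congr_deriv (by ring)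

/-- FTC kernel for the induction step: `d/dt [−(1−t)^{n+1}e^{tz}] = (n+1)(1−t)ⁿe^{tz} − z(1−t)^{n+1}e^{tz}`.
[folklore] -/
private theorem hasDerivAt_kernel (n : ℕ) (z : ℂ) (t : ℝ) :
    HasDerivAt (fun s : ℝ => -((1 - (s : ℂ)) ^ (n + 1) * cexp ((s : ℂ) * z)))
      (((n : ℂ) + 1) * ((1 - (t : ℂ)) ^ n * cexp ((t : ℂ) * z))
        - z * ((1 - (t : ℂ)) ^ (n + 1) * cexp ((t : ℂ) * z))) t := by
  have h1 : HasDerivAt (fun w : ℂ => (1 - w) ^ (n + 1))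
      (((n + 1 : ℕ) : ℂ) * (1 - (t : ℂ)) ^ (n + 1 - 1) * (-1)) (t : ℂ) :=
    ((hasDerivAt_id' (t : ℂ)).const_sub 1).fun_pow (n + 1)
  have h2 : HasDerivAt (fun w : ℂ => cexp (w * z)) (cexp ((t : ℂ) * z) * (1 * z)) (t : ℂ) :=
    ((hasDerivAt_id' (t : ℂ)).mul_const z).cexp
  have h3 := ((h1.mul h2).neg).comp_ofReal
  refine h3.congr_deriv ?_
  simp only [Nat.add_sub_cancel, Nat.cast_add, Nat.cast_one]
  ring

/-- The kernel integrands are continuous, hence interval-integrable. [folklore] -/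
private theorem intervalIntegrable_kernel (m : ℕ) (z : ℂ) :
    IntervalIntegrable (fun t : ℝ => (1 - (t : ℂ)) ^ m * cexp ((t : ℂ) * z)) MeasureTheory.volume 0 1 :=
  (by fun_prop : Continuous fun t : ℝ => (1 - (t : ℂ)) ^ m * cexp ((t : ℂ) * z)).intervalIntegrable 0 1

/-- Base case of (3.14): `z∫₀¹e^{tz}dt = e^z − 1` (FTC; no division by `z`). [folklore] -/
private theorem kernel_base (z : ℂ) : z * (∫ t in (0:ℝ)..1, cexp ((t : ℂ) * z)) = cexp z - 1 := by
  have hint : IntervalIntegrable (fun t : ℝ => z * cexp ((t : ℂ) * z)) MeasureTheory.volume 0 1 :=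
    (by fun_prop : Continuous fun t : ℝ => z * cexp ((t : ℂ) * z)).intervalIntegrable 0 1
  have hftc := integral_eq_sub_of_hasDerivAt (fun t _ => hasDerivAt_exp_line z t) hint
  rw [integral_const_mul] at hftc
  simpa using hftc

/-- Induction step of (3.14), the integration by parts `(n+1)∫₀¹(1−t)ⁿe^{tz}dt = 1 + z∫₀¹(1−t)^{n+1}e^{tz}dt`, i.e.
`R_{n+1}(z) = 1 + (z/(n+2))·R_{n+2}(z)`. [folklore] -/
private theorem kernel_step (n : ℕ) (z : ℂ) :
    ((n : ℂ) + 1) * (∫ t in (0:ℝ)..1, (1 - (t : ℂ)) ^ n * cexp ((t : ℂ) * z))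
      = 1 + z * ∫ t in (0:ℝ)..1, (1 - (t : ℂ)) ^ (n + 1) * cexp ((t : ℂ) * z) := by
  have hI := intervalIntegrable_kernel n z
  have hJ := intervalIntegrable_kernel (n + 1) z
  have hftc := integral_eq_sub_of_hasDerivAt (fun t _ => hasDerivAt_kernel n z t)
    ((hI.const_mul ((n : ℂ) + 1)).sub (hJ.const_mul z))
  rw [integral_sub (hI.const_mul _) (hJ.const_mul _), integral_const_mul, integral_const_mul] at hftc
  simp at hftc
  linear_combination hftc

/-- (3.14) in the normalised form used for the induction: `exp z = Σ_{m ≤ n} z^m/m! +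
z^{n+1}/(n+1)! · ((n+1)∫₀¹(1−t)ⁿe^{tz}dt)`. [cite: Balaban1982Higgs1, (3.14) p.614] -/
private theorem exp_taylor_integral (n : ℕ) (z : ℂ) :
    cexp z = ∑ m ∈ Finset.range (n + 1), z ^ m / (m.factorial : ℂ)
      + z ^ (n + 1) / ((n + 1).factorial : ℂ) *
        (((n : ℂ) + 1) * ∫ t in (0:ℝ)..1, (1 - (t : ℂ)) ^ n * cexp ((t : ℂ) * z)) := by
  induction n with
  | zero =>
      have h0 := kernel_base z
      simp
      linear_combination -h0
  | succ n ih =>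
      have hrec := kernel_step n z
      rw [hrec] at ih
      have hfac : (((n + 1 + 1).factorial : ℕ) : ℂ) = ((n : ℂ) + 1 + 1) * ((n + 1).factorial : ℂ) := by
        rw [Nat.factorial_succ (n + 1)]; push_cast; ring
      have hne : (((n + 1).factorial : ℕ) : ℂ) ≠ 0 := Nat.cast_ne_zero.mpr (Nat.factorial_ne_zero _)
      have hne2 : ((n : ℂ) + 1 + 1) ≠ 0 := by
        have : ((n : ℂ) + 1 + 1) = ((n + 2 : ℕ) : ℂ) := by push_cast; ring
        rw [this]; exact Nat.cast_ne_zero.mpr (by omega)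
      rw [ih, Finset.sum_range_succ _ (n + 1), hfac]
      push_cast
      field_simp
      ring

/-- **(3.14) p. 614, PROVED** — the decl of record `B1Sect3Statements.Eq314` holds for every `n̄ : ℕ` and every
`z : ℂ`: `U = exp z = Σ_{n=0}^{n̄} zⁿ/n! + z^{n̄+1}/(n̄+1)! · R_{n̄+1}(z)` with `R_{n̄+1}(z) =
(n̄+1)∫₀¹(1−t)^{n̄}e^{tz}dt` (`B1Sect3Statements.taylorRem`).  Textbook Taylor formula with integral remainder, by
induction on `n̄` with one integration by parts per step. [cite: Balaban1982Higgs1, (3.14) p.614] -/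
theorem eq314_holds (nbar : ℕ) (z : ℂ) : Eq314 nbar z := by
  unfold Eq314 taylorRem
  simp_rw [Complex.ofReal_sub, Complex.ofReal_one]
  exact exp_taylor_integral nbar z

/-- (3.14) with r12's `F′_{1,k}`: `F′_{1,k}(z) := U − 1 = Σ_{n=1}^{n̄} zⁿ/n! + z^{n̄+1}/(n̄+1)! · R_{n̄+1}(z)` (the
sum now from `n = 1`, as printed). [cite: Balaban1982Higgs1, (3.14) p.614] -/
theorem F1prime_eq (nbar : ℕ) (z : ℂ) :
    F1prime z = ∑ n ∈ Finset.Ico 1 (nbar + 1), z ^ n / (n.factorial : ℂ)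
      + z ^ (nbar + 1) / ((nbar + 1).factorial : ℂ) * taylorRem nbar z := by
  have h := eq314_holds nbar z
  unfold Eq314 at h
  rw [F1prime, h, Finset.range_eq_Ico, Finset.sum_eq_sum_Ico_succ_bot (Nat.succ_pos nbar)]
  simp only [pow_zero, Nat.factorial_zero, Nat.cast_one, div_one]
  ring

end Taylor

/-! ## 2. (3.11): completing the square under the translation (3.10) -/

section Split

variable {V U : Type*} [AddCommGroup V] [Module ℝ V] [AddCommGroup U] [Module ℝ U]

/-- **(3.11) p. 614, PROVED in general form (first = middle member).**  Over real vector spaces `V ∋ A, A′` and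
`U ∋ B` with bilinear scalar products `bK = ⟨·,·⟩_V`, `bM = ⟨·,·⟩_U` ((1.5); `bM` symmetric), a linear `Q : V → U`
with adjoint `Qstar` (`⟨Qv, u⟩_U = ⟨v, Q*u⟩_V`, p. 604), a `⟨·,·⟩_V`-symmetric `D : V → V` (↤ −Δ + μ₀²ε², i.e.
Δ^{(0)} (2.17)), a scalar `c` (↤ aL⁻²) and `C : V → V` with `(cQ*Q + D)C = 1` (↤ C^{(0)}, (2.31)): the quadratic form of
(3.7), `qAB(A,B) = ½c⟨B − QA, B − QA⟩_U + ½⟨A, DA⟩_V`, evaluated at the translated field (3.10) `A = A′ + cCQ*B`,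
splits as `½⟨B, (c·1 − c²QCQ*)B⟩_U + ½(c⟨QA′, QA′⟩_U + ⟨A′, DA′⟩_V)` — the sum of the two forms of (3.11), the first
being `½⟨B, Δ^{(1),L}B⟩` by (2.21) (k = 1, G₁ = C^{(0)}, a₁ = a). [cite: Balaban1982Higgs1, (3.11) p.614] -/
theorem split311_of_minimiser (bK : V →ₗ[ℝ] V →ₗ[ℝ] ℝ) (bM : U →ₗ[ℝ] U →ₗ[ℝ] ℝ)
    (hM : ∀ u v, bM u v = bM v u)
    (c : ℝ) (Q : V →ₗ[ℝ] U) (Qstar : U →ₗ[ℝ] V) (hadj : ∀ v u, bM (Q v) u = bK v (Qstar u))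
    (D : V →ₗ[ℝ] V) (hD : ∀ u v, bK u (D v) = bK v (D u))
    (C : V →ₗ[ℝ] V) (hC : ∀ v, c • Qstar (Q (C v)) + D (C v) = v) :
    Split311 c C Qstar (fun A B => 1 / 2 * c * bM (B - Q A) (B - Q A) + 1 / 2 * bK A (D A))
      (fun B => 1 / 2 * bM B (c • B - c ^ 2 • Q (C (Qstar B))))
      (fun A' => 1 / 2 * (c * bM (Q A') (Q A') + bK A' (D A'))) := by
  intro A' B
  simp only [transl310]
  set w := C (Qstar B) with hw
  have hMw : c • Qstar (Q w) + D w = Qstar B := hC (Qstar B)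
  have f1 : bM (Q A') B = bK A' (Qstar B) := hadj A' B
  have f2 : bM B (Q A') = bK A' (Qstar B) := by rw [hM]; exact hadj A' B
  have f3 : bM B (Q w) = bK w (Qstar B) := by rw [hM]; exact hadj w B
  have f4 : bM (Q w) B = bK w (Qstar B) := hadj w B
  have f6 : bM (Q A') (Q w) = bK A' (Qstar (Q w)) := hadj A' (Q w)
  have f7 : bM (Q w) (Q A') = bK A' (Qstar (Q w)) := by rw [hM]; exact hadj A' (Q w)
  have f8 : bM (Q w) (Q w) = bK w (Qstar (Q w)) := hadj w (Q w)
  have f9 : bK A' (D w) = bK A' (Qstar B) - c * bK A' (Qstar (Q w)) := by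
    have h := congrArg (bK A') hMw
    rw [map_add, map_smul, smul_eq_mul] at h
    linarith
  have f10 : bK w (D A') = bK A' (Qstar B) - c * bK A' (Qstar (Q w)) := by rw [hD]; exact f9
  have f11 : bK w (D w) = bK w (Qstar B) - c * bK w (Qstar (Q w)) := by
    have h := congrArg (bK w) hMw
    rw [map_add, map_smul, smul_eq_mul] at h
    linarith
  simp only [map_add, map_sub, map_smul, LinearMap.add_apply, LinearMap.sub_apply, LinearMap.smul_apply,
    smul_eq_mul, f1, f2, f3, f4, f6, f7, f8, f9, f10, f11]
  ring

/-- **(3.11) p. 614, PROVED in general form (first = right member)**: as `split311_of_minimiser`, with the second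
form written `½⟨A′, (C^{(0)})⁻¹A′⟩_V`, `(C^{(0)})⁻¹ = cQ*Q + D` ((2.31): `C^{(0)} = (aL⁻²P + Δ^{(0)})⁻¹`, `P = Q*Q`
(2.20)) — the printed equality of the middle and right members of (3.11) is the adjointness `c⟨QA′, QA′⟩_U =
⟨A′, cQ*QA′⟩_V`. [cite: Balaban1982Higgs1, (3.11) p.614] -/
theorem split311_of_minimiser' (bK : V →ₗ[ℝ] V →ₗ[ℝ] ℝ) (bM : U →ₗ[ℝ] U →ₗ[ℝ] ℝ)
    (hM : ∀ u v, bM u v = bM v u)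
    (c : ℝ) (Q : V →ₗ[ℝ] U) (Qstar : U →ₗ[ℝ] V) (hadj : ∀ v u, bM (Q v) u = bK v (Qstar u))
    (D : V →ₗ[ℝ] V) (hD : ∀ u v, bK u (D v) = bK v (D u))
    (C : V →ₗ[ℝ] V) (hC : ∀ v, c • Qstar (Q (C v)) + D (C v) = v) :
    Split311 c C Qstar (fun A B => 1 / 2 * c * bM (B - Q A) (B - Q A) + 1 / 2 * bK A (D A))
      (fun B => 1 / 2 * bM B (c • B - c ^ 2 • Q (C (Qstar B))))
      (fun A' => 1 / 2 * bK A' (c • Qstar (Q A') + D A')) := by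
  intro A' B
  have h := split311_of_minimiser bK bM hM c Q Qstar hadj D hD C hC A' B
  simp only at h ⊢
  rw [h, map_add, map_smul, smul_eq_mul, ← hadj]

/-- **(3.11) p. 614 over real inner-product spaces** (the (3.7) form literally `½c‖B − QA‖² + ½⟨A, DA⟩`):
`qAB(A′ + cCQ*B, B) = ½(c‖B‖² − c²⟨B, QCQ*B⟩) + ½(c‖QA′‖² + ⟨A′, DA′⟩)` under adjointness of `Q*`, symmetry of
`D` and `(cQ*Q + D)C = 1`. [cite: Balaban1982Higgs1, (3.11) p.614] -/
theorem split311_inner {V U : Type*} [NormedAddCommGroup V] [InnerProductSpace ℝ V] [NormedAddCommGroup U]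
    [InnerProductSpace ℝ U] (c : ℝ) (Q : V →ₗ[ℝ] U) (Qstar : U →ₗ[ℝ] V)
    (hadj : ∀ v u, inner ℝ (Q v) u = inner ℝ v (Qstar u))
    (D : V →ₗ[ℝ] V) (hD : ∀ u v, inner ℝ u (D v) = inner ℝ v (D u))
    (C : V →ₗ[ℝ] V) (hC : ∀ v, c • Qstar (Q (C v)) + D (C v) = v) :
    Split311 c C Qstar (fun A B => 1 / 2 * c * ‖B - Q A‖ ^ 2 + 1 / 2 * inner ℝ A (D A))
      (fun B => 1 / 2 * (c * ‖B‖ ^ 2 - c ^ 2 * inner ℝ B (Q (C (Qstar B)))))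
      (fun A' => 1 / 2 * (c * ‖Q A'‖ ^ 2 + inner ℝ A' (D A'))) := by
  have h := split311_of_minimiser (innerₗ V) (innerₗ U) (fun u v => real_inner_comm v u) c Q Qstar
    (fun v u => by simpa using hadj v u) D (fun u v => by simpa using hD u v) C hC
  intro A' B
  have h' := h A' B
  simp only [innerₗ_apply_apply, real_inner_self_eq_norm_sq] at h'
  simp only [inner_sub_right, real_inner_smul_right, real_inner_self_eq_norm_sq] at h'
  exact h'

end Split

/-! ## 3. (3.11) on the concrete carrier of B1 Sect. 2: finite lattices, real matrices, weighted scalar products (1.5)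
(`B1RG242.StepData`) -/

section MatrixForm

open Matrix

variable {κ ν : Type*} [Fintype κ] [Fintype ν] [DecidableEq κ] [DecidableEq ν]

/-- **(3.11) p. 614 for matrices** (operators on the finite lattices `κ` = sites of the current unit lattice `T₁^{(k)}`
carrying `A`, `ν` = sites of the L-lattice carrying `B`; scalar products (1.5) `⟨u,v⟩ = u ⬝ᵥ (W *ᵥ v)`, `W_M`
symmetric; `Qs` the adjoint of `Q`; `D` symmetric for `⟨·,·⟩_K`; `(c•Q*Q + D)·C = 1`):
`qAB(A′ + c·CQ*B, B) = ½⟨B, (c·1 − c²·QCQ*)B⟩_M + ½⟨A′, (c·Q*Q + D)A′⟩_K`. [cite: Balaban1982Higgs1, (3.11) p.614] -/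
theorem split311_matrix (WK : Matrix κ κ ℝ) (WM : Matrix ν ν ℝ)
    (symM : ∀ u v, u ⬝ᵥ (WM *ᵥ v) = v ⬝ᵥ (WM *ᵥ u))
    (c : ℝ) (Q : Matrix ν κ ℝ) (Qs : Matrix κ ν ℝ)
    (adj : ∀ ψ θ, ψ ⬝ᵥ (WK *ᵥ (Qs *ᵥ θ)) = (Q *ᵥ ψ) ⬝ᵥ (WM *ᵥ θ))
    (D : Matrix κ κ ℝ) (symD : ∀ u v, u ⬝ᵥ (WK *ᵥ (D *ᵥ v)) = v ⬝ᵥ (WK *ᵥ (D *ᵥ u)))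
    (C : Matrix κ κ ℝ) (hC : (c • (Qs * Q) + D) * C = 1) :
    Split311 c C.mulVecLin Qs.mulVecLin
      (fun A B => 1 / 2 * c * ((B - Q *ᵥ A) ⬝ᵥ (WM *ᵥ (B - Q *ᵥ A))) + 1 / 2 * (A ⬝ᵥ (WK *ᵥ (D *ᵥ A))))
      (fun B => 1 / 2 * (B ⬝ᵥ (WM *ᵥ ((c • (1 : Matrix ν ν ℝ) - c ^ 2 • (Q * C * Qs)) *ᵥ B))))
      (fun A' => 1 / 2 * (A' ⬝ᵥ (WK *ᵥ ((c • (Qs * Q) + D) *ᵥ A')))) := by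
  have h := split311_of_minimiser' (Matrix.toLinearMap₂' ℝ WK) (Matrix.toLinearMap₂' ℝ WM)
    (fun u v => by simpa only [Matrix.toLinearMap₂'_apply'] using symM u v)
    c Q.mulVecLin Qs.mulVecLin
    (fun v u => by simpa only [Matrix.toLinearMap₂'_apply', Matrix.mulVecLin_apply] using (adj v u).symm)
    D.mulVecLin
    (fun u v => by simpa only [Matrix.toLinearMap₂'_apply', Matrix.mulVecLin_apply] using symD u v)
    C.mulVecLin (fun v => by
      have h1 := congrArg (fun M : Matrix κ κ ℝ => M *ᵥ v) hC
      simpa only [Matrix.add_mulVec, Matrix.smul_mulVec, Matrix.one_mulVec, ← Matrix.mulVec_mulVec,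
        Matrix.mulVecLin_apply] using h1)
  intro A' B
  have h' := h A' B
  simp only [Matrix.toLinearMap₂'_apply', Matrix.mulVecLin_apply, transl310] at h' ⊢
  rw [h']
  simp only [Matrix.sub_mulVec, Matrix.add_mulVec, Matrix.smul_mulVec, Matrix.one_mulVec,
    ← Matrix.mulVec_mulVec]

end MatrixForm

/-! ### The `B1RG242.StepData` instance: c = β = aL⁻², C = C^{(k)} (2.30), D = Δ^{(k)} (2.21) -/

section StepDataInstance

open Matrix B1RG242 B1RG242.StepData

variable {ι κ ν : Type*} [Fintype ι] [Fintype κ] [Fintype ν] [DecidableEq ι] [DecidableEq κ] [DecidableEq ν]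
variable (S : B1RG242.StepData ℝ ι κ ν)

omit [Fintype ν] [DecidableEq ν] in
/-- `Δ^{(k)} = α·1 − α²·Q_kG_kQ*_k` (2.21) is symmetric for `⟨·,·⟩_K` as soon as the weights `W_E`, `W_K` are
symmetric, `−Δ^{ε,N}_{A,Ω} + m²` is symmetric for `⟨·,·⟩_E`, `Q*_k` is the (1.5)-adjoint of `Q_k` and `G_k` (2.20) is a
genuine inverse — the Euclidean structure of B1 (1.5)/(2.17)/(2.20). [cite: Balaban1982Higgs1, (2.21) p.610] -/
theorem stepData_Δk_symm {WE : Matrix ι ι ℝ} {WK : Matrix κ κ ℝ}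
    (symE : ∀ φ ψ, φ ⬝ᵥ (WE *ᵥ ψ) = ψ ⬝ᵥ (WE *ᵥ φ)) (symK : ∀ u v, u ⬝ᵥ (WK *ᵥ v) = v ⬝ᵥ (WK *ᵥ u))
    (symH : ∀ φ ψ, φ ⬝ᵥ (WE *ᵥ (S.H *ᵥ ψ)) = ψ ⬝ᵥ (WE *ᵥ (S.H *ᵥ φ)))
    (adjk : ∀ φ ψ, φ ⬝ᵥ (WE *ᵥ (S.Qks *ᵥ ψ)) = (S.Qk *ᵥ φ) ⬝ᵥ (WK *ᵥ ψ))
    (hG : IsUnit (S.H + S.α • S.Pk)) (u v : κ → ℝ) :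
    u ⬝ᵥ (WK *ᵥ (S.Δk *ᵥ v)) = v ⬝ᵥ (WK *ᵥ (S.Δk *ᵥ u)) := by
  -- N := H + αP_k is symmetric for ⟨·,·⟩_E
  have symN : ∀ a b, a ⬝ᵥ (WE *ᵥ ((S.H + S.α • S.Pk) *ᵥ b)) = b ⬝ᵥ (WE *ᵥ ((S.H + S.α • S.Pk) *ᵥ a)) := by
    intro a b
    simp only [Pk, Matrix.add_mulVec, Matrix.smul_mulVec, ← Matrix.mulVec_mulVec, Matrix.mulVec_add,
      Matrix.mulVec_smul, dotProduct_add, dotProduct_smul, smul_eq_mul, symH a b, adjk]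
    rw [symK]
  -- hence G_k = N⁻¹ is symmetric for ⟨·,·⟩_E
  have hNG : (S.H + S.α • S.Pk) * S.Gk = 1 := S.Gk_mul hG
  have symG : ∀ x y, x ⬝ᵥ (WE *ᵥ (S.Gk *ᵥ y)) = y ⬝ᵥ (WE *ᵥ (S.Gk *ᵥ x)) := by
    intro x y
    have ex : x = (S.H + S.α • S.Pk) *ᵥ (S.Gk *ᵥ x) := by rw [Matrix.mulVec_mulVec, hNG, Matrix.one_mulVec]
    have ey : y = (S.H + S.α • S.Pk) *ᵥ (S.Gk *ᵥ y) := by rw [Matrix.mulVec_mulVec, hNG, Matrix.one_mulVec]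
    calc x ⬝ᵥ (WE *ᵥ (S.Gk *ᵥ y))
        = ((S.H + S.α • S.Pk) *ᵥ (S.Gk *ᵥ x)) ⬝ᵥ (WE *ᵥ (S.Gk *ᵥ y)) := by rw [← ex]
      _ = (S.Gk *ᵥ y) ⬝ᵥ (WE *ᵥ ((S.H + S.α • S.Pk) *ᵥ (S.Gk *ᵥ x))) := symE _ _
      _ = (S.Gk *ᵥ x) ⬝ᵥ (WE *ᵥ ((S.H + S.α • S.Pk) *ᵥ (S.Gk *ᵥ y))) := symN _ _
      _ = (S.Gk *ᵥ x) ⬝ᵥ (WE *ᵥ y) := by rw [← ey]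
      _ = y ⬝ᵥ (WE *ᵥ (S.Gk *ᵥ x)) := symE _ _
  -- the Q_kG_kQ*_k term
  have symT : ∀ a b : κ → ℝ, a ⬝ᵥ (WK *ᵥ (S.Qk *ᵥ (S.Gk *ᵥ (S.Qks *ᵥ b))))
      = b ⬝ᵥ (WK *ᵥ (S.Qk *ᵥ (S.Gk *ᵥ (S.Qks *ᵥ a)))) := by
    intro a b
    rw [symK, ← adjk, symE, symG, symE, adjk, symK]
  simp only [Δk, Matrix.sub_mulVec, Matrix.smul_mulVec, Matrix.one_mulVec, ← Matrix.mulVec_mulVec,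
    Matrix.mulVec_sub, Matrix.mulVec_smul, dotProduct_sub, dotProduct_smul, smul_eq_mul]
  rw [symK u v, symT u v]

/-- **(3.11) p. 614 (k = 0) / (3.41) p. 619 / (3.49) p. 621 — MODEL INSTANCE on `B1RG242.StepData`**: with the (1.5)
scalar products `⟨u,v⟩_K = u ⬝ᵥ (W_K *ᵥ v)`, `⟨·,·⟩_M` (symmetric weight), `Q*` the adjoint of `Q`, `Δ^{(k)}`
symmetric for `⟨·,·⟩_K` (e.g. by `stepData_Δk_symm`) and `aL⁻²P + Δ^{(k)}` invertible ("It is so", p. 611): the k-th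
step form `½β⟨B − QA, B − QA⟩_M + ½⟨A, Δ^{(k)}A⟩_K` (β = aL⁻²; at k = 0 the A,B-form of (3.7)) at the translated
field (3.10)/(3.41) `A = A′ + aL⁻²C^{(k)}Q*B` equals `½⟨B, (β·1 − β²·QC^{(k)}Q*)B⟩_M + ½⟨A′, (C^{(k)})⁻¹A′⟩_K`,
`(C^{(k)})⁻¹ = aL⁻²P + Δ^{(k)}` (2.31). [cite: Balaban1982Higgs1, (3.11) p.614] -/
theorem split311_stepData (WK : Matrix κ κ ℝ) (WM : Matrix ν ν ℝ)
    (symM : ∀ u v, u ⬝ᵥ (WM *ᵥ v) = v ⬝ᵥ (WM *ᵥ u))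
    (adj : ∀ ψ θ, ψ ⬝ᵥ (WK *ᵥ (S.Qs *ᵥ θ)) = (S.Q *ᵥ ψ) ⬝ᵥ (WM *ᵥ θ))
    (symΔ : ∀ u v, u ⬝ᵥ (WK *ᵥ (S.Δk *ᵥ v)) = v ⬝ᵥ (WK *ᵥ (S.Δk *ᵥ u)))
    (hC : IsUnit (S.β • S.P + S.Δk)) :
    Split311 S.β S.Ck.mulVecLin S.Qs.mulVecLin
      (fun A B => 1 / 2 * S.β * ((B - S.Q *ᵥ A) ⬝ᵥ (WM *ᵥ (B - S.Q *ᵥ A)))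
        + 1 / 2 * (A ⬝ᵥ (WK *ᵥ (S.Δk *ᵥ A))))
      (fun B => 1 / 2 * (B ⬝ᵥ (WM *ᵥ ((S.β • (1 : Matrix ν ν ℝ) - S.β ^ 2 • (S.Q * S.Ck * S.Qs)) *ᵥ B))))
      (fun A' => 1 / 2 * (A' ⬝ᵥ (WK *ᵥ ((S.β • S.P + S.Δk) *ᵥ A')))) :=
  split311_matrix WK WM symM S.β S.Q S.Qs adj S.Δk symΔ S.Ck (S.Ck_mul hC)

/-- The same with the B-form written in the PRINTED (2.21)-shape one level up, `Δ^{(k+1)} = γ·1 −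
γ²·Q_{k+1}G_{k+1}Q*_{k+1}` (`γ = a_{k+1}(L^{k+1}ε)⁻²`), via `display221_succ` (consistency of (2.18) with (2.21)) —
so the first form of (3.11)/(3.41) is `½⟨B, Δ^{(k+1),L}B⟩` as printed, under QQ* = 1 and the invertibility of the
arguments of G_k (2.20) and C^{(k)} (2.30). [cite: Balaban1982Higgs1, (3.11) p.614] -/
theorem split311_stepData_221 (WK : Matrix κ κ ℝ) (WM : Matrix ν ν ℝ)
    (symM : ∀ u v, u ⬝ᵥ (WM *ᵥ v) = v ⬝ᵥ (WM *ᵥ u))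
    (adj : ∀ ψ θ, ψ ⬝ᵥ (WK *ᵥ (S.Qs *ᵥ θ)) = (S.Q *ᵥ ψ) ⬝ᵥ (WM *ᵥ θ))
    (symΔ : ∀ u v, u ⬝ᵥ (WK *ᵥ (S.Δk *ᵥ v)) = v ⬝ᵥ (WK *ᵥ (S.Δk *ᵥ u)))
    (hQ : S.Q * S.Qs = 1) (hαβ : S.α + S.β ≠ 0) (hG : IsUnit (S.H + S.α • S.Pk))
    (hC : IsUnit (S.β • S.P + S.Δk)) :
    Split311 S.β S.Ck.mulVecLin S.Qs.mulVecLin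
      (fun A B => 1 / 2 * S.β * ((B - S.Q *ᵥ A) ⬝ᵥ (WM *ᵥ (B - S.Q *ᵥ A)))
        + 1 / 2 * (A ⬝ᵥ (WK *ᵥ (S.Δk *ᵥ A))))
      (fun B => 1 / 2 * (B ⬝ᵥ (WM *ᵥ ((S.γ • (1 : Matrix ν ν ℝ) - S.γ ^ 2 • (S.Qk1 * S.Gk1 * S.Qk1s)) *ᵥ B))))
      (fun A' => 1 / 2 * (A' ⬝ᵥ (WK *ᵥ ((S.β • S.P + S.Δk) *ᵥ A')))) := by
  rw [← S.display221_succ hQ hαβ hG hC]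
  exact split311_stepData S WK WM symM adj symΔ hC

/-- (3.11)/(3.41) from the PRIMITIVE Euclidean data only: symmetric weights `W_E`, `W_K`, `W_M`, `−Δ^{ε,N}_{A,Ω} + m²`
symmetric, the adjointness fields of `ScalarProducts`, and the invertibility of the arguments of G_k and C^{(k)} —
`Δ^{(k)}`'s symmetry is then `stepData_Δk_symm`. [cite: Balaban1982Higgs1, (3.11) p.614] -/
theorem split311_of_scalarProducts {WE : Matrix ι ι ℝ} {WK : Matrix κ κ ℝ}
    {WM : Matrix ν ν ℝ} (E : S.ScalarProducts WE WK WM)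
    (symE : ∀ φ ψ, φ ⬝ᵥ (WE *ᵥ ψ) = ψ ⬝ᵥ (WE *ᵥ φ)) (symK : ∀ u v, u ⬝ᵥ (WK *ᵥ v) = v ⬝ᵥ (WK *ᵥ u))
    (symM : ∀ u v, u ⬝ᵥ (WM *ᵥ v) = v ⬝ᵥ (WM *ᵥ u))
    (symH : ∀ φ ψ, φ ⬝ᵥ (WE *ᵥ (S.H *ᵥ ψ)) = ψ ⬝ᵥ (WE *ᵥ (S.H *ᵥ φ)))
    (hG : IsUnit (S.H + S.α • S.Pk)) (hC : IsUnit (S.β • S.P + S.Δk)) :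
    Split311 S.β S.Ck.mulVecLin S.Qs.mulVecLin
      (fun A B => 1 / 2 * S.β * ((B - S.Q *ᵥ A) ⬝ᵥ (WM *ᵥ (B - S.Q *ᵥ A)))
        + 1 / 2 * (A ⬝ᵥ (WK *ᵥ (S.Δk *ᵥ A))))
      (fun B => 1 / 2 * (B ⬝ᵥ (WM *ᵥ ((S.β • (1 : Matrix ν ν ℝ) - S.β ^ 2 • (S.Q * S.Ck * S.Qs)) *ᵥ B))))
      (fun A' => 1 / 2 * (A' ⬝ᵥ (WK *ᵥ ((S.β • S.P + S.Δk) *ᵥ A')))) :=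
  split311_stepData S WK WM symM E.adj (stepData_Δk_symm S symE symK symH E.adjk hG) hC

end StepDataInstance

end Literature.MathematicalPhysics.QuantumFieldTheory.Balaban1983to89.B1Eq314Proof
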